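import Summits.RiemannHypothesis.RiemannHypothesis.Theorems.TiltedLandingLaw421R2NodeD
import Summits.RiemannHypothesis.RiemannHypothesis.Theses.EarlyAppointments

/-! # trkD_v2 — W-08 ROUND-2 LINE for crux `TiltedLandingLaw421` (stmt-RiemannHypothesis-24774): tracked down-first lineage `StTrkD`, stop `ReadyR2 := CumReady (WindowReady ∨ TiltReady)`
((CA306) round-2 word), HEIGHT purse + SIGNED tolls (C1 §R2K row R5, the weakest REST text typed). Tenure DRY image — NOT keyed, NOT registered (registration = lead on a director RELEASE line).
STUBS (2): `stub_zRestTrkDHF'  : RhW08.Round2.ZRestTrkDHF'` and `stub_alphaSealTrkD' : RhW08.Round2.AlphaSealTrkD'`.  COMPOSITION (0 sorry outside the stubs): `RhW08.R2Node.law421T_of_round2DF` ⇒ the ROUTE DECL BY NAME.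
Typed ≠ proved; models (combs) ≠ ξ; RH is NOT proved. -/

namespace Summit.RiemannHypothesis.RiemannHypothesis.Cruxes.TiltedLandingLaw421.TrkDV2

set_option linter.dupNamespace false

/-- STUB (REST′, signed, height purse) — `RhW08.Round2.ZRestTrkDHF'`. -/
theorem stub_zRestTrkDHF' : RhW08.Round2.ZRestTrkDHF' := by
  sorry

/-- STUB (α′) — `RhW08.Round2.AlphaSealTrkD'` = isolated-pair drop-low on lowest TRACKED states sealed by `PSealC4`, stop `ReadyR2`. -/
theorem stub_alphaSealTrkD' : RhW08.Round2.AlphaSealTrkD' := by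
  sorry

/-- **COMPOSITION** — the stubs prove the crux `TiltedLandingLaw421` (route `EarlyAppointments`, stmt-RiemannHypothesis-24774) BY NAME. -/
theorem TiltedLandingLaw421_of : Summit.RiemannHypothesis.RiemannHypothesis.Theses.EarlyAppointments.TiltedLandingLaw421 :=
  RhW08.R2Node.law421T_of_round2DF stub_zRestTrkDHF' stub_alphaSealTrkD'

end Summit.RiemannHypothesis.RiemannHypothesis.Cruxes.TiltedLandingLaw421.TrkDV2
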